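import Mathlib
import Summits.KontsevichZagierPeriods.Zeta5Search.BrickHoleStrip
import Summits.KontsevichZagierPeriods.Zeta5Search.BrickHatWeight

/-!
# BrickHoleMultiplier — zi-p2's THEOREM 10 LEMMA 10.2 (a): the MULTIPLIER of a hole cell in closed form through unit
factorials (Legendre one step with the CLASS CARRIES `ε₁, ε₂`), and `p^A ∣ μ_K` where
`μ_K := c_{K,A}(N)/c̃_{K',A}(m)` is the ratio that weights the hole cell against the row `m = N' − 1` (cell zeta5-irr)

HONEST FRAMING: systematic search; no irrationality claim unless certified. INSTRUMENT lemmas of the ζ(5)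
census cell zeta5-irr (HOME `run/shared/lean/pub/zeta5-irr/`; memo `zi-p2/probes/B8/thm10/THEOREM10.md` (sealed
eeb9a92811d678e0) LEMMA 10.2 «(a) Legendre one step on the three binomials … C(N,K) = p·(N′−K′)C(N′,K′)·ρ₁°;
C(N+K,K) = p^{ε₁}·C(N′+K′,K′)(N′+K′+1)^{ε₁}·ρ₂°; C(2N−K,N) = p^{ε₂}·C(2N′−1−K′,N′)(2N′−K′)^{ε₂}·ρ₃° … so v(Λ_K) = A +
B|ε| + c EXACTLY»). DESIGN: the hole cells of a row are weighted against the row `m = N′ − 1` of `R̃` by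
`μ_K = c_{K,A}(N)/c̃_{K′,A}(m) = a_K·holePoly_K(0)` (`a_K` the constant of `BrickHoleStrip.laurentSeries_rescale_eq_hole`);
its reflection law `μ_{N−K} = (−1)^ε μ_K` is then `BrickTopCoefficient.cTop_reflect` verbatim (no class bookkeeping), and
only `p^A ∣ μ_K` and the digit-locality of `μ` (sequel file) are needed for the H^∞ induction. Nothing here is about
ζ(5); no irrationality content; filing moves no rung. Filed by the engine seat zi-eng (g10); the class-carry twin of
`BrickHatMultiplier` (trivial class) and `BrickLambdaClosedForm` (° cells).

## The statements (digits: row `n₀ < p`, cell `i`, complement `i'` with `i + i' = n₀ + p`, `i, i' < p` — so `i > n₀`,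
a HOLE digit; blocks `J + M = m`, row `n = n₀ + (m+1)p`, cell `k = i + Jp`, `n − k = i' + Mp`; class carries
`e₁ = (n₀ + i)/p`, `e₂ = (n₀ + i')/p`)

* `hole_choose_mul_uf`, `hole_choose_add_mul_uf`, `hole_choose_two_sub_mul_uf`: the three Legendre identities in `ℕ`.
* defs `holeUnitPart` (`Û_k`), `holeGainPart` (`Ŷ_k`, with the paid class members `(p(m+2+J))^{e₁}`, `(p(2m+2−J))^{e₂}`);
  **`cTop_mul_holeUnitPart`**, **`mu_mul_holeUnitPart`** (closed form of `μ·Û·(m+1)^{2B}`), **`padicValuation_mu_le`**: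
  `v(μ_k) ≤ exp(−A)` for any `μ` with `μ·c̃_{J,A}(m) = c_{k,A}(n)` (`A` even, `p` odd, `2B ≤ A`).
-/

namespace Summit.KontsevichZagierPeriods.Zeta5Search.BrickHoleMultiplier

open Finset Nat Polynomial WithZero
open Summit.KontsevichZagierPeriods.Zeta5Search.BrickTopCoefficient (cTop)
open Summit.KontsevichZagierPeriods.Zeta5Search.BrickLambda (cTop_zero_ne_zero padicValuation_two)
open Summit.KontsevichZagierPeriods.Zeta5Search.GaussWilsonBlock (unitFactorial)
open Summit.KontsevichZagierPeriods.Zeta5Search.BrickLambdaClosedForm (factorial_eq_unitFactorial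
  padicValuation_unitFactorial)
open Summit.KontsevichZagierPeriods.Zeta5Search.BrickHatStrip (hatPoly hatPoly_eval_zero_ne_zero)
open Summit.KontsevichZagierPeriods.Zeta5Search.BrickHatMultiplier (hatPoly_mul_cTop_zero)
open Summit.KontsevichZagierPeriods.Zeta5Search.BrickHatWeight (padicValuation_hatPoly_eval_zero_le)
open Literature.NumberTheory.LFunctions (padicValuation_natCast_le_one)

variable {p : ℕ} [Fact p.Prime]

/-! ## Legendre one step with class carries -/

section legendre

variable {n₀ i i' : ℕ} (hii : i + i' = n₀ + p) (hi : i < p) (hi' : i' < p) (hn₀ : n₀ < p) (J M : ℕ)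
include hii hi hi' hn₀

/-- `C(n,k)·k!_p·(n−k)!_p = p·(m+1)·C(m,J)·n!_p` (`n = n₀ + (J+M+1)p`, `k = i + Jp`, `n − k = i' + Mp`). -/
theorem hole_choose_mul_uf :
    (n₀ + (J + M + 1) * p).choose (i + J * p) * unitFactorial p (i + J * p) * unitFactorial p (i' + M * p) =
      p * (J + M + 1) * (J + M).choose J * unitFactorial p (n₀ + (J + M + 1) * p) := by
  have hp : p.Prime := Fact.out
  have e0 : i' + M * p + (i + J * p) = n₀ + (J + M + 1) * p := by
    calc i' + M * p + (i + J * p) = (i + i') + (J + M) * p := by ring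
      _ = _ := by rw [hii]; ring
  have h1 := Nat.add_choose_mul_factorial_mul_factorial (i' + M * p) (i + J * p)
  rw [e0] at h1
  have hK := factorial_eq_unitFactorial (p := p) (i + J * p)
  have hK' := factorial_eq_unitFactorial (p := p) (i' + M * p)
  have hN := factorial_eq_unitFactorial (p := p) (n₀ + (J + M + 1) * p)
  rw [Nat.add_mul_div_right _ _ hp.pos, Nat.div_eq_of_lt hi, zero_add] at hK
  rw [Nat.add_mul_div_right _ _ hp.pos, Nat.div_eq_of_lt hi', zero_add] at hK'
  rw [Nat.add_mul_div_right _ _ hp.pos, Nat.div_eq_of_lt hn₀, zero_add] at hN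
  have h2 := Nat.add_choose_mul_factorial_mul_factorial M J
  rw [add_comm M J] at h2
  have hp0 : 0 < p := hp.pos
  have hD : 0 < p ^ (J + M) * J ! * M ! := by positivity
  refine Nat.eq_of_mul_eq_mul_right hD ?_
  calc _ = (n₀ + (J + M + 1) * p).choose (i + J * p) * (p ^ M * M ! * unitFactorial p (i' + M * p)) *
        (p ^ J * J ! * unitFactorial p (i + J * p)) := by rw [pow_add]; ring
    _ = (n₀ + (J + M + 1) * p)! := by rw [← hK', ← hK, ← h1]
    _ = _ := by rw [hN, pow_succ, Nat.factorial_succ, ← h2]; ring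

omit hii hi' in
/-- `C(n+k,k)·k!_p·n!_p = (p(m+2+J))^{e₁}·C(m+1+J,J)·(n+k)!_p`, `e₁ = (n₀+i)/p` (`n + k = (n₀+i) + (m+1+J)p`). -/
theorem hole_choose_add_mul_uf :
    (n₀ + (J + M + 1) * p + (i + J * p)).choose (i + J * p) * unitFactorial p (i + J * p) *
        unitFactorial p (n₀ + (J + M + 1) * p) =
      (p * (J + M + 1 + J + 1)) ^ ((n₀ + i) / p) * (J + M + 1 + J).choose J *
        unitFactorial p (n₀ + (J + M + 1) * p + (i + J * p)) := by
  have hp : p.Prime := Fact.out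
  set ca := (n₀ + i) / p with hca
  have hca1 : ca ≤ 1 := Nat.lt_succ_iff.1 ((Nat.div_lt_iff_lt_mul hp.pos).2 (by omega))
  have h1 := Nat.add_choose_mul_factorial_mul_factorial (n₀ + (J + M + 1) * p) (i + J * p)
  have hK := factorial_eq_unitFactorial (p := p) (i + J * p)
  have hN := factorial_eq_unitFactorial (p := p) (n₀ + (J + M + 1) * p)
  have hS := factorial_eq_unitFactorial (p := p) (n₀ + (J + M + 1) * p + (i + J * p))
  rw [Nat.add_mul_div_right _ _ hp.pos, Nat.div_eq_of_lt hi, zero_add] at hK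
  rw [Nat.add_mul_div_right _ _ hp.pos, Nat.div_eq_of_lt hn₀, zero_add] at hN
  have e0 : n₀ + (J + M + 1) * p + (i + J * p) = n₀ + i + (J + M + 1 + J) * p := by ring
  rw [e0, Nat.add_mul_div_right _ _ hp.pos, ← hca, ← e0] at hS
  have h2 := Nat.add_choose_mul_factorial_mul_factorial (J + M + 1) J
  have h5 : (ca + (J + M + 1 + J))! = (J + M + 1 + J + 1) ^ ca * (J + M + 1 + J)! := by
    interval_cases ca
    · simp
    · rw [show 1 + (J + M + 1 + J) = (J + M + 1 + J) + 1 by ring, Nat.factorial_succ, pow_one]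
  have hp0 : 0 < p := hp.pos
  have hD : 0 < p ^ (J + M + 1 + J) * (J + M + 1)! * J ! := by positivity
  refine Nat.eq_of_mul_eq_mul_right hD ?_
  calc _ = (n₀ + (J + M + 1) * p + (i + J * p)).choose (i + J * p) *
        (p ^ (J + M + 1) * (J + M + 1)! * unitFactorial p (n₀ + (J + M + 1) * p)) *
        (p ^ J * J ! * unitFactorial p (i + J * p)) := by rw [pow_add]; ring
    _ = (n₀ + (J + M + 1) * p + (i + J * p))! := by rw [← hK, ← hN, ← h1]
    _ = _ := by rw [hS, h5, ← h2, mul_pow]; ring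

omit hii hi in
/-- `C(2n−k,n)·n!_p·(n−k)!_p = (p(2m+2−J))^{e₂}·C(2m+1−J,m+1)·(2n−k)!_p`, `e₂ = (n₀+i')/p`
(`2n − k = (n−k) + n = (n₀+i') + (M + m + 1)p`, `2m + 1 − J = M + (m+1)`). -/
theorem hole_choose_two_sub_mul_uf :
    (i' + M * p + (n₀ + (J + M + 1) * p)).choose (n₀ + (J + M + 1) * p) * unitFactorial p (n₀ + (J + M + 1) * p) *
        unitFactorial p (i' + M * p) =
      (p * (J + M + 1 + M + 1)) ^ ((n₀ + i') / p) * (M + (J + M + 1)).choose (J + M + 1) *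
        unitFactorial p (i' + M * p + (n₀ + (J + M + 1) * p)) := by
  have hp : p.Prime := Fact.out
  set cb := (n₀ + i') / p with hcb
  have hcb1 : cb ≤ 1 := Nat.lt_succ_iff.1 ((Nat.div_lt_iff_lt_mul hp.pos).2 (by omega))
  have h1 := Nat.add_choose_mul_factorial_mul_factorial (i' + M * p) (n₀ + (J + M + 1) * p)
  have hK' := factorial_eq_unitFactorial (p := p) (i' + M * p)
  have hN := factorial_eq_unitFactorial (p := p) (n₀ + (J + M + 1) * p)
  have hS := factorial_eq_unitFactorial (p := p) (i' + M * p + (n₀ + (J + M + 1) * p))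
  rw [Nat.add_mul_div_right _ _ hp.pos, Nat.div_eq_of_lt hi', zero_add] at hK'
  rw [Nat.add_mul_div_right _ _ hp.pos, Nat.div_eq_of_lt hn₀, zero_add] at hN
  have e0 : i' + M * p + (n₀ + (J + M + 1) * p) = n₀ + i' + (M + (J + M + 1)) * p := by ring
  rw [e0, Nat.add_mul_div_right _ _ hp.pos, ← hcb, ← e0] at hS
  have h2 := Nat.add_choose_mul_factorial_mul_factorial M (J + M + 1)
  have h5 : (cb + (M + (J + M + 1)))! = (J + M + 1 + M + 1) ^ cb * (M + (J + M + 1))! := by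
    interval_cases cb
    · simp
    · rw [show 1 + (M + (J + M + 1)) = (M + (J + M + 1)) + 1 by ring, Nat.factorial_succ, pow_one,
        show M + (J + M + 1) + 1 = J + M + 1 + M + 1 by ring]
  have hp0 : 0 < p := hp.pos
  have hD : 0 < p ^ (M + (J + M + 1)) * M ! * (J + M + 1)! := by positivity
  refine Nat.eq_of_mul_eq_mul_right hD ?_
  calc _ = (i' + M * p + (n₀ + (J + M + 1) * p)).choose (n₀ + (J + M + 1) * p) *
        (p ^ M * M ! * unitFactorial p (i' + M * p)) *
        (p ^ (J + M + 1) * (J + M + 1)! * unitFactorial p (n₀ + (J + M + 1) * p)) := by rw [pow_add]; ring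
    _ = (i' + M * p + (n₀ + (J + M + 1) * p))! := by rw [← hK', ← hN, ← h1]
    _ = _ := by rw [hS, h5, ← h2, mul_pow]; ring

end legendre

/-! ## The closed form of the hole multiplier -/

/-- The UNIT PART `Û_k = (k!_p(n−k)!_p)^A·(k!_p n!_p)^B·(n!_p(n−k)!_p)^B ∈ ℕ` of the hole cell with row digit `n₀`,
cell digits `i, i'`, blocks `J, M`. -/
def holeUnitPart (p A B n₀ i i' J M : ℕ) : ℕ :=
  (unitFactorial p (i + J * p) * unitFactorial p (i' + M * p)) ^ A *
    (unitFactorial p (i + J * p) * unitFactorial p (n₀ + (J + M + 1) * p)) ^ B *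
    (unitFactorial p (n₀ + (J + M + 1) * p) * unitFactorial p (i' + M * p)) ^ B

/-- The GAINED PART `Ŷ_k = (n!_p)^A·((p(m+2+J))^{e₁}(n+k)!_p)^B·((p(2m+2−J))^{e₂}(2n−k)!_p)^B ∈ ℕ` (the class members
`p(m+2+J)`, `p(2m+2−J)` are PAID here: each carries one factor `p`). -/
def holeGainPart (p A B n₀ i i' J M : ℕ) : ℕ :=
  unitFactorial p (n₀ + (J + M + 1) * p) ^ A *
    ((p * (J + M + 1 + J + 1)) ^ ((n₀ + i) / p) * unitFactorial p (n₀ + (J + M + 1) * p + (i + J * p))) ^ B *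
    ((p * (J + M + 1 + M + 1)) ^ ((n₀ + i') / p) * unitFactorial p (i' + M * p + (n₀ + (J + M + 1) * p))) ^ B

/-- `Û_k` is a `p`-adic unit. -/
theorem padicValuation_holeUnitPart (A B n₀ i i' J M : ℕ) :
    Rat.padicValuation p (holeUnitPart p A B n₀ i i' J M : ℚ) = 1 := by
  unfold holeUnitPart
  push_cast
  simp only [map_mul, map_pow, padicValuation_unitFactorial, one_pow, mul_one]

/-- `Ŷ_k ∈ ℤ`: `v(Ŷ_k) ≤ 1`. -/
theorem padicValuation_holeGainPart_le (A B n₀ i i' J M : ℕ) :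
    Rat.padicValuation p (holeGainPart p A B n₀ i i' J M : ℚ) ≤ 1 := padicValuation_natCast_le_one _

section closed

variable (hp2 : p ≠ 2) {A B ε n₀ i i' J M : ℕ} (hA : Even A) (hAB : 2 * B ≤ A) (hii : i + i' = n₀ + p) (hi : i < p)
  (hi' : i' < p) (hn₀ : n₀ < p)
include hii hi hi' hn₀

/-- `c_{k,A}(n)·Û_k = (−1)^{nB+kA}·(n/2 − k)^ε·(p(m+1)C(m,J))^A·(C(m+1+J,J)·C(M+m+1,m+1))^B·Ŷ_k`. -/
theorem cTop_mul_holeUnitPart :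
    cTop A B ε (n₀ + (J + M + 1) * p) (i + J * p) * (holeUnitPart p A B n₀ i i' J M : ℚ) =
      (-1) ^ ((n₀ + (J + M + 1) * p) * B + (i + J * p) * A) *
        ((((n₀ + (J + M + 1) * p : ℕ) : ℚ)) / 2 - ((i + J * p : ℕ) : ℚ)) ^ ε *
        (((p : ℚ) * ((J + M + 1 : ℕ) : ℚ) * (((J + M).choose J : ℕ) : ℚ)) ^ A *
          ((((J + M + 1 + J).choose J : ℕ) : ℚ) * (((M + (J + M + 1)).choose (J + M + 1) : ℕ) : ℚ)) ^ B) *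
        (holeGainPart p A B n₀ i i' J M : ℚ) := by
  have hρ1 : (((n₀ + (J + M + 1) * p).choose (i + J * p) : ℕ) : ℚ) * (unitFactorial p (i + J * p) : ℚ) *
      (unitFactorial p (i' + M * p) : ℚ) =
      (p : ℚ) * ((J + M + 1 : ℕ) : ℚ) * (((J + M).choose J : ℕ) : ℚ) *
        (unitFactorial p (n₀ + (J + M + 1) * p) : ℚ) := by
    exact_mod_cast hole_choose_mul_uf hii hi hi' hn₀ J M
  have hρ2 : (((n₀ + (J + M + 1) * p + (i + J * p)).choose (i + J * p) : ℕ) : ℚ) *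
      (unitFactorial p (i + J * p) : ℚ) * (unitFactorial p (n₀ + (J + M + 1) * p) : ℚ) =
      ((p : ℚ) * ((J + M + 1 + J + 1 : ℕ) : ℚ)) ^ ((n₀ + i) / p) * (((J + M + 1 + J).choose J : ℕ) : ℚ) *
        (unitFactorial p (n₀ + (J + M + 1) * p + (i + J * p)) : ℚ) := by
    exact_mod_cast hole_choose_add_mul_uf hi hn₀ J M
  have hρ3 : (((i' + M * p + (n₀ + (J + M + 1) * p)).choose (n₀ + (J + M + 1) * p) : ℕ) : ℚ) *
      (unitFactorial p (n₀ + (J + M + 1) * p) : ℚ) * (unitFactorial p (i' + M * p) : ℚ) =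
      ((p : ℚ) * ((J + M + 1 + M + 1 : ℕ) : ℚ)) ^ ((n₀ + i') / p) *
        (((M + (J + M + 1)).choose (J + M + 1) : ℕ) : ℚ) *
        (unitFactorial p (i' + M * p + (n₀ + (J + M + 1) * p)) : ℚ) := by
    exact_mod_cast hole_choose_two_sub_mul_uf hi' hn₀ J M
  have e2 : 2 * (n₀ + (J + M + 1) * p) - (i + J * p) = i' + M * p + (n₀ + (J + M + 1) * p) := by
    have : 2 * (n₀ + (J + M + 1) * p) = (i + J * p) + (i' + M * p + (n₀ + (J + M + 1) * p)) := by
      calc 2 * (n₀ + (J + M + 1) * p) = (i + i') + (J + M) * p + (n₀ + (J + M + 1) * p) := by rw [hii]; ring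
        _ = _ := by ring
    omega
  unfold cTop holeUnitPart holeGainPart
  rw [e2]
  simp only [Nat.cast_mul, Nat.cast_pow]
  calc _ = (-1) ^ ((n₀ + (J + M + 1) * p) * B + (i + J * p) * A) *
        ((((n₀ + (J + M + 1) * p : ℕ) : ℚ)) / 2 - ((i + J * p : ℕ) : ℚ)) ^ ε *
        ((((n₀ + (J + M + 1) * p).choose (i + J * p) : ℕ) : ℚ) * (unitFactorial p (i + J * p) : ℚ) *
          (unitFactorial p (i' + M * p) : ℚ)) ^ A *
        (((((n₀ + (J + M + 1) * p + (i + J * p)).choose (i + J * p) : ℕ) : ℚ) * (unitFactorial p (i + J * p) : ℚ) *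
          (unitFactorial p (n₀ + (J + M + 1) * p) : ℚ)) *
          ((((i' + M * p + (n₀ + (J + M + 1) * p)).choose (n₀ + (J + M + 1) * p) : ℕ) : ℚ) *
          (unitFactorial p (n₀ + (J + M + 1) * p) : ℚ) * (unitFactorial p (i' + M * p) : ℚ))) ^ B := by
        simp only [Nat.cast_mul, Nat.cast_add, Nat.cast_one]; ring
    _ = _ := by rw [hρ1, hρ2, hρ3]; ring

include hA in
/-- **LEMMA 10.2 (a), closed form of the hole multiplier**: any `μ` with `μ·c̃_{J,A}(m) = c_{k,A}(n)` (`m = J + M`,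
`n = n₀ + (m+1)p`, `k = i + Jp`) satisfies `μ·Û_k·(m+1)^{2B} = s·(n/2 − k)^ε·p^A·(m+1)^A·Ê_J(0)·Ŷ_k` with the sign
`s = (−1)^{(n+m+1)B}` and the hat factor `Ê_J(0) = (−(J+m+1))^B(2m+1−J)^B` — so `μ_k = (hole unit)·p^{A+B|ε|(+c)}·
(m+1)^{A−2B}·Ê_J(0)·(class values)`, zi-p2's `Λ_K·(m+1)^{A−2B}·Ê·Q^{cl}_0` up to her normalisation. -/
theorem mu_mul_holeUnitPart {mu : ℚ} (hmu : mu * cTop A B 0 (J + M) J = cTop A B ε (n₀ + (J + M + 1) * p) (i + J * p)) :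
    mu * (holeUnitPart p A B n₀ i i' J M : ℚ) * (((J + M + 1 : ℕ) : ℚ)) ^ (2 * B) =
      (-1) ^ ((n₀ + (J + M + 1) * p) * B + (J + M + 1) * B) *
        ((((n₀ + (J + M + 1) * p : ℕ) : ℚ)) / 2 - ((i + J * p : ℕ) : ℚ)) ^ ε *
        ((p : ℚ) ^ A * (((J + M + 1 : ℕ) : ℚ)) ^ A) * (hatPoly B (J + M) J).eval 0 *
        (holeGainPart p A B n₀ i i' J M : ℚ) := by
  have hp : p.Prime := Fact.out
  have hhat := hatPoly_mul_cTop_zero (A := A) (B := B) (J := J) (M := M)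
  have key := cTop_mul_holeUnitPart (p := p) (A := A) (B := B) (ε := ε) (J := J) (M := M) hii hi hi' hn₀
  rw [← hmu] at key
  have hT0 : (((J + M).choose J : ℕ) : ℚ) ^ A *
      ((((J + M + 1 + J).choose J : ℕ) : ℚ) * (((M + (J + M + 1)).choose (J + M + 1) : ℕ) : ℚ)) ^ B ≠ 0 := by
    have h1 : 0 < (J + M).choose J := Nat.choose_pos (Nat.le_add_right J M)
    have h2 : 0 < (J + M + 1 + J).choose J := Nat.choose_pos (by omega)
    have h3 : 0 < (M + (J + M + 1)).choose (J + M + 1) := Nat.choose_pos (Nat.le_add_left _ _)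
    positivity
  have hsA : ∀ x : ℕ, ((-1 : ℚ)) ^ (x * A) = 1 := fun x => (hA.mul_left x).neg_one_pow
  have hs00 : ((-1 : ℚ)) ^ ((J + M + 1) * B + J * A) * (-1) ^ ((J + M + 1) * B + J * A) = 1 := by
    rw [← pow_add, ← two_mul, pow_mul, neg_one_sq, one_pow]
  have hsign : ((-1 : ℚ)) ^ ((n₀ + (J + M + 1) * p) * B + (i + J * p) * A) * (-1) ^ ((J + M + 1) * B + J * A) =
      (-1) ^ ((n₀ + (J + M + 1) * p) * B + (J + M + 1) * B) := by
    rw [pow_add, pow_add, pow_add, hsA, hsA, mul_one, mul_one]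
  -- multiply `key` by `Ê_J(0)` and substitute the hat identity
  have key' : mu * (holeUnitPart p A B n₀ i i' J M : ℚ) * ((-1) ^ ((J + M + 1) * B + J * A) *
      (((J + M + 1 : ℕ) : ℚ)) ^ (2 * B) * ((((J + M).choose J : ℕ) : ℚ) ^ A *
        ((((J + M + 1 + J).choose J : ℕ) : ℚ) * (((M + (J + M + 1)).choose (J + M + 1) : ℕ) : ℚ)) ^ B)) =
      (-1) ^ ((n₀ + (J + M + 1) * p) * B + (i + J * p) * A) *
        ((((n₀ + (J + M + 1) * p : ℕ) : ℚ)) / 2 - ((i + J * p : ℕ) : ℚ)) ^ ε *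
        (((p : ℚ) * ((J + M + 1 : ℕ) : ℚ) * (((J + M).choose J : ℕ) : ℚ)) ^ A *
          ((((J + M + 1 + J).choose J : ℕ) : ℚ) * (((M + (J + M + 1)).choose (J + M + 1) : ℕ) : ℚ)) ^ B) *
        (holeGainPart p A B n₀ i i' J M : ℚ) * (hatPoly B (J + M) J).eval 0 := by
    calc _ = mu * (holeUnitPart p A B n₀ i i' J M : ℚ) * ((hatPoly B (J + M) J).eval 0 * cTop A B 0 (J + M) J) := by
          rw [hhat]
      _ = mu * cTop A B 0 (J + M) J * (holeUnitPart p A B n₀ i i' J M : ℚ) * (hatPoly B (J + M) J).eval 0 := by ring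
      _ = _ := by rw [key]
  apply mul_right_cancel₀ hT0
  have e1 : mu * (holeUnitPart p A B n₀ i i' J M : ℚ) * (((J + M + 1 : ℕ) : ℚ)) ^ (2 * B) *
      ((((J + M).choose J : ℕ) : ℚ) ^ A *
        ((((J + M + 1 + J).choose J : ℕ) : ℚ) * (((M + (J + M + 1)).choose (J + M + 1) : ℕ) : ℚ)) ^ B) =
      mu * (holeUnitPart p A B n₀ i i' J M : ℚ) * ((-1) ^ ((J + M + 1) * B + J * A) *
        (((J + M + 1 : ℕ) : ℚ)) ^ (2 * B) * ((((J + M).choose J : ℕ) : ℚ) ^ A *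
        ((((J + M + 1 + J).choose J : ℕ) : ℚ) * (((M + (J + M + 1)).choose (J + M + 1) : ℕ) : ℚ)) ^ B)) *
        (-1) ^ ((J + M + 1) * B + J * A) := by
    linear_combination (-(mu * (holeUnitPart p A B n₀ i i' J M : ℚ) * (((J + M + 1 : ℕ) : ℚ)) ^ (2 * B) *
      ((((J + M).choose J : ℕ) : ℚ) ^ A *
        ((((J + M + 1 + J).choose J : ℕ) : ℚ) * (((M + (J + M + 1)).choose (J + M + 1) : ℕ) : ℚ)) ^ B))) * hs00
  rw [e1, key']
  linear_combination (((((n₀ + (J + M + 1) * p : ℕ) : ℚ)) / 2 - ((i + J * p : ℕ) : ℚ)) ^ ε *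
    ((p : ℚ) ^ A * (((J + M + 1 : ℕ) : ℚ)) ^ A) * (hatPoly B (J + M) J).eval 0 *
    (holeGainPart p A B n₀ i i' J M : ℚ) * ((((J + M).choose J : ℕ) : ℚ) ^ A *
      ((((J + M + 1 + J).choose J : ℕ) : ℚ) * (((M + (J + M + 1)).choose (J + M + 1) : ℕ) : ℚ)) ^ B)) * hsign

include hp2 hA hAB in
/-- **`p^A ∣ μ_k`**: `v(μ_k) ≤ exp(−A)` for any `μ` with `μ·c̃_{J,A}(m) = c_{k,A}(n)` — the hole cell's top coefficient
is `p^A` times (`p`-integral) times the top coefficient of the cell `J` of the row `m = N' − 1` of `R̃` (zi-p2: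
`v(Λ_K) = A + B|ε| + c`; only `≥ A` is recorded here). -/
theorem padicValuation_mu_le {mu : ℚ}
    (hmu : mu * cTop A B 0 (J + M) J = cTop A B ε (n₀ + (J + M + 1) * p) (i + J * p)) :
    Rat.padicValuation p mu ≤ exp (-(A : ℤ)) := by
  have hp : p.Prime := Fact.out
  have hpQ : (p : ℚ) ≠ 0 := by exact_mod_cast hp.ne_zero
  have hnQ : (((J + M + 1 : ℕ) : ℚ)) ≠ 0 := by positivity
  have h := congrArg (Rat.padicValuation p) (mu_mul_holeUnitPart hA hii hi hi' hn₀ (ε := ε) (J := J) (M := M) hmu)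
  simp only [map_mul, map_pow, Valuation.map_neg, map_one, one_pow, one_mul, padicValuation_holeUnitPart, mul_one,
    Rat.padicValuation_self] at h
  rw [← exp_nsmul, nsmul_eq_mul, mul_neg_one] at h
  have vn : Rat.padicValuation p (((J + M + 1 : ℕ) : ℚ)) ≤ 1 := padicValuation_natCast_le_one _
  have vn0 : Rat.padicValuation p (((J + M + 1 : ℕ) : ℚ)) ≠ 0 := (Valuation.ne_zero_iff _).2 hnQ
  have hcen : Rat.padicValuation p ((((n₀ + (J + M + 1) * p : ℕ) : ℚ)) / 2 - ((i + J * p : ℕ) : ℚ)) ≤ 1 := by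
    rw [show (((n₀ + (J + M + 1) * p : ℕ) : ℚ)) / 2 - ((i + J * p : ℕ) : ℚ) =
        ((((n₀ + (J + M + 1) * p : ℕ) : ℤ) - 2 * (i + J * p : ℕ) : ℤ) : ℚ) / 2 by push_cast; ring,
      map_div₀, padicValuation_two hp2, div_one, Rat.padicValuation_cast]
    exact Int.padicValuation_le_one _ _
  have hsplit : Rat.padicValuation p (((J + M + 1 : ℕ) : ℚ)) ^ A =
      Rat.padicValuation p (((J + M + 1 : ℕ) : ℚ)) ^ (A - 2 * B) * Rat.padicValuation p (((J + M + 1 : ℕ) : ℚ)) ^ (2 * B) := by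
    rw [← pow_add, Nat.sub_add_cancel hAB]
  have key : Rat.padicValuation p mu * Rat.padicValuation p (((J + M + 1 : ℕ) : ℚ)) ^ (2 * B) ≤
      exp (-(A : ℤ)) * Rat.padicValuation p (((J + M + 1 : ℕ) : ℚ)) ^ (2 * B) := by
    rw [h, hsplit]
    calc _ ≤ 1 * (exp (-(A : ℤ)) * (1 * Rat.padicValuation p (((J + M + 1 : ℕ) : ℚ)) ^ (2 * B))) * 1 * 1 :=
          mul_le_mul' (mul_le_mul' (mul_le_mul' (pow_le_one' hcen ε)
            (mul_le_mul' le_rfl (mul_le_mul' (pow_le_one' vn _) le_rfl))) (padicValuation_hatPoly_eval_zero_le B _ _))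
            (padicValuation_holeGainPart_le A B n₀ i i' J M)
      _ = _ := by rw [one_mul, one_mul, mul_one, mul_one]
  have hX0 : Rat.padicValuation p (((J + M + 1 : ℕ) : ℚ)) ^ (2 * B) ≠ 0 := pow_ne_zero _ vn0
  have h' := mul_le_mul' (le_refl (Rat.padicValuation p (((J + M + 1 : ℕ) : ℚ)) ^ (2 * B))⁻¹) key
  rwa [mul_comm (Rat.padicValuation p mu), mul_comm (exp (-(A : ℤ))), ← mul_assoc, ← mul_assoc,
    inv_mul_cancel₀ hX0, one_mul, one_mul] at h'

end closed

end Summit.KontsevichZagierPeriods.Zeta5Search.BrickHoleMultiplier
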